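import Summits.CriticalPhenomena.SAWScalingLimit.Theorems.SAWTotalPositivityBoundaryTP2Strip4PairSym
import Summits.CriticalPhenomena.SAWScalingLimit.Theorems.SAWTotalPositivityBoundaryTP2Strip4Base
import Summits.CriticalPhenomena.SAWScalingLimit.Theorems.SAWTotalPositivityBoundaryTP2Strip4Interlaced
import Summits.CriticalPhenomena.SAWScalingLimit.Theorems.SAWTotalPositivityBoundaryTP2Strip4RecNear
import Summits.CriticalPhenomena.SAWScalingLimit.Theorems.SAWTotalPositivityBoundaryTP2Strip4RecPair201
import Summits.CriticalPhenomena.SAWScalingLimit.Theorems.SAWTotalPositivityBoundaryTP2Strip4RecCorner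
import Summits.CriticalPhenomena.SAWScalingLimit.Theorems.SAWTotalPositivityBoundaryTP2Strip4RecPair301
import Summits.CriticalPhenomena.SAWScalingLimit.Theorems.SAWTotalPositivityBoundaryTP2Strip4RecPair302
import Summits.CriticalPhenomena.SAWScalingLimit.Theorems.SAWTotalPositivityBoundaryTP2Strip4RecPair312
import HarnessLib

/-!
# Crux `BoundaryTP2` (stmt-CriticalPhenomena-7115), line `Sketch`: the odd sector of the width-4 transfer
as real sequences (lead c6, bridge of the width-4 transfer, part 2)

For a start-row pair `(r₁, r₂) = (r, 3 - r)` the twelve oriented kernels of the 4-row strip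
`S_n = rectDomain n 3` from `(0,r)` — four point kernels `K_n(r→s)` and eight disjoint-pair kernels
`PP_n(r; s; u→v)` in the orientations of the registered identities — obey the validated 12-state transfer
recursion (tool stubs `stub_strip4_recCorner/recNear/recPair201/301/302/312`, both row labellings), are
exchanged by the reflection `j ↦ 3 - j` (`stub_rect_reflect`, `rect_pairSum_reflect_snd`), and have the
single-column initial values of `stub_strip4_base`.  Consequently the SIGNED ODD COORDINATES
`a = K(r₁→0) - K(r₂→0)`, `b = K(r₁→1) - K(r₂→1)`, `p = -(PP(r₁;2;0→1) - PP(r₂;2;0→1))`,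
`q = -(PP(·;3;0→1) difference)`, `r = -(PP(·;3;0→2) difference)`, `t = PP(r₂;3;1→2) - PP(r₁;3;1→2)` are real
sequences obeying the 6-dimensional signed odd recursion of `stub_strip4_oddBoxStep`
(`strip4_oddSector_exists`), with the initial vectors of `stub_strip4_oddBoxBase03/12`.  Only the identity row
labelling of the recursions is used, plus the reflection of the POINT kernels; the even twin is
`strip4_evenSector_exists` (…Strip4EvenBridge).
-/

noncomputable section

namespace Summit.CriticalPhenomena.SAWScalingLimit.Theorems.BoundaryTP2

open Literature.Probability.LatticeModels Literature.Probability.RandomPlanarGeometry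
open Summit.CriticalPhenomena.SAWScalingLimit.Theorems.EdgeOfPositivity.Negative
open scoped ENNReal

/-! ## `toReal` of the transfer identities -/

section ToReal
variable {x : ℝ}

/-- Finiteness of a scaled finite term. [folklore] -/
private theorem s4ob_fin_mul {c : ℝ} {B : ℝ≥0∞} (hB : B ≠ ∞) : ENNReal.ofReal c * B ≠ ∞ :=
  ENNReal.mul_ne_top ENNReal.ofReal_ne_top hB

/-- `toReal` of a scaled term. [folklore] -/
private theorem s4ob_tr {c : ℝ} (hc : 0 ≤ c) (B : ℝ≥0∞) : (ENNReal.ofReal c * B).toReal = c * B.toReal := by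
  rw [ENNReal.toReal_mul, ENNReal.toReal_ofReal hc]

/-- `toReal` of a three-term identity. [folklore] -/
theorem strip4_toReal3 {c₁ c₂ c₃ : ℝ} (h₁ : 0 ≤ c₁) (h₂ : 0 ≤ c₂) (h₃ : 0 ≤ c₃) {A B₁ B₂ B₃ : ℝ≥0∞}
    (hB₁ : B₁ ≠ ∞) (hB₂ : B₂ ≠ ∞) (hB₃ : B₃ ≠ ∞)
    (h : A = ENNReal.ofReal c₁ * B₁ + ENNReal.ofReal c₂ * B₂ + ENNReal.ofReal c₃ * B₃) :
    A.toReal = c₁ * B₁.toReal + c₂ * B₂.toReal + c₃ * B₃.toReal := by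
  rw [h, ENNReal.toReal_add (ENNReal.add_ne_top.2 ⟨s4ob_fin_mul hB₁, s4ob_fin_mul hB₂⟩) (s4ob_fin_mul hB₃),
    ENNReal.toReal_add (s4ob_fin_mul hB₁) (s4ob_fin_mul hB₂), s4ob_tr h₁, s4ob_tr h₂, s4ob_tr h₃]

/-- `toReal` of a four-term identity. [folklore] -/
theorem strip4_toReal4 {c₁ c₂ c₃ c₄ : ℝ} (h₁ : 0 ≤ c₁) (h₂ : 0 ≤ c₂) (h₃ : 0 ≤ c₃) (h₄ : 0 ≤ c₄)
    {A B₁ B₂ B₃ B₄ : ℝ≥0∞} (hB₁ : B₁ ≠ ∞) (hB₂ : B₂ ≠ ∞) (hB₃ : B₃ ≠ ∞) (hB₄ : B₄ ≠ ∞)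
    (h : A = ENNReal.ofReal c₁ * B₁ + ENNReal.ofReal c₂ * B₂ + ENNReal.ofReal c₃ * B₃ +
      ENNReal.ofReal c₄ * B₄) :
    A.toReal = c₁ * B₁.toReal + c₂ * B₂.toReal + c₃ * B₃.toReal + c₄ * B₄.toReal := by
  have h3 : ENNReal.ofReal c₁ * B₁ + ENNReal.ofReal c₂ * B₂ + ENNReal.ofReal c₃ * B₃ ≠ ∞ :=
    ENNReal.add_ne_top.2 ⟨ENNReal.add_ne_top.2 ⟨s4ob_fin_mul hB₁, s4ob_fin_mul hB₂⟩, s4ob_fin_mul hB₃⟩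
  rw [h, ENNReal.toReal_add h3 (s4ob_fin_mul hB₄), strip4_toReal3 h₁ h₂ h₃ hB₁ hB₂ hB₃ rfl, s4ob_tr h₄]

/-- `toReal` of a five-term identity. [folklore] -/
theorem strip4_toReal5 {c₁ c₂ c₃ c₄ c₅ : ℝ} (h₁ : 0 ≤ c₁) (h₂ : 0 ≤ c₂) (h₃ : 0 ≤ c₃) (h₄ : 0 ≤ c₄)
    (h₅ : 0 ≤ c₅) {A B₁ B₂ B₃ B₄ B₅ : ℝ≥0∞} (hB₁ : B₁ ≠ ∞) (hB₂ : B₂ ≠ ∞) (hB₃ : B₃ ≠ ∞) (hB₄ : B₄ ≠ ∞)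
    (hB₅ : B₅ ≠ ∞)
    (h : A = ENNReal.ofReal c₁ * B₁ + ENNReal.ofReal c₂ * B₂ + ENNReal.ofReal c₃ * B₃ +
      ENNReal.ofReal c₄ * B₄ + ENNReal.ofReal c₅ * B₅) :
    A.toReal = c₁ * B₁.toReal + c₂ * B₂.toReal + c₃ * B₃.toReal + c₄ * B₄.toReal + c₅ * B₅.toReal := by
  have h4 : ENNReal.ofReal c₁ * B₁ + ENNReal.ofReal c₂ * B₂ + ENNReal.ofReal c₃ * B₃ +
      ENNReal.ofReal c₄ * B₄ ≠ ∞ :=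
    ENNReal.add_ne_top.2 ⟨ENNReal.add_ne_top.2 ⟨ENNReal.add_ne_top.2 ⟨s4ob_fin_mul hB₁, s4ob_fin_mul hB₂⟩,
      s4ob_fin_mul hB₃⟩, s4ob_fin_mul hB₄⟩
  rw [h, ENNReal.toReal_add h4 (s4ob_fin_mul hB₅), strip4_toReal4 h₁ h₂ h₃ h₄ hB₁ hB₂ hB₃ hB₄ rfl,
    s4ob_tr h₅]

/-- `toReal` of a six-term identity. [folklore] -/
theorem strip4_toReal6 {c₁ c₂ c₃ c₄ c₅ c₆ : ℝ} (h₁ : 0 ≤ c₁) (h₂ : 0 ≤ c₂) (h₃ : 0 ≤ c₃) (h₄ : 0 ≤ c₄)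
    (h₅ : 0 ≤ c₅) (h₆ : 0 ≤ c₆) {A B₁ B₂ B₃ B₄ B₅ B₆ : ℝ≥0∞} (hB₁ : B₁ ≠ ∞) (hB₂ : B₂ ≠ ∞)
    (hB₃ : B₃ ≠ ∞) (hB₄ : B₄ ≠ ∞) (hB₅ : B₅ ≠ ∞) (hB₆ : B₆ ≠ ∞)
    (h : A = ENNReal.ofReal c₁ * B₁ + ENNReal.ofReal c₂ * B₂ + ENNReal.ofReal c₃ * B₃ +
      ENNReal.ofReal c₄ * B₄ + ENNReal.ofReal c₅ * B₅ + ENNReal.ofReal c₆ * B₆) :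
    A.toReal = c₁ * B₁.toReal + c₂ * B₂.toReal + c₃ * B₃.toReal + c₄ * B₄.toReal + c₅ * B₅.toReal +
      c₆ * B₆.toReal := by
  have h5 : ENNReal.ofReal c₁ * B₁ + ENNReal.ofReal c₂ * B₂ + ENNReal.ofReal c₃ * B₃ +
      ENNReal.ofReal c₄ * B₄ + ENNReal.ofReal c₅ * B₅ ≠ ∞ :=
    ENNReal.add_ne_top.2 ⟨ENNReal.add_ne_top.2 ⟨ENNReal.add_ne_top.2 ⟨ENNReal.add_ne_top.2
      ⟨s4ob_fin_mul hB₁, s4ob_fin_mul hB₂⟩, s4ob_fin_mul hB₃⟩, s4ob_fin_mul hB₄⟩, s4ob_fin_mul hB₅⟩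
  rw [h, ENNReal.toReal_add h5 (s4ob_fin_mul hB₆), strip4_toReal5 h₁ h₂ h₃ h₄ h₅ hB₁ hB₂ hB₃ hB₄ hB₅ rfl,
    s4ob_tr h₆]

/-- `toReal` of an eight-term identity. [folklore] -/
theorem strip4_toReal8 {c₁ c₂ c₃ c₄ c₅ c₆ c₇ c₈ : ℝ} (h₁ : 0 ≤ c₁) (h₂ : 0 ≤ c₂) (h₃ : 0 ≤ c₃)
    (h₄ : 0 ≤ c₄) (h₅ : 0 ≤ c₅) (h₆ : 0 ≤ c₆) (h₇ : 0 ≤ c₇) (h₈ : 0 ≤ c₈)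
    {A B₁ B₂ B₃ B₄ B₅ B₆ B₇ B₈ : ℝ≥0∞} (hB₁ : B₁ ≠ ∞) (hB₂ : B₂ ≠ ∞) (hB₃ : B₃ ≠ ∞) (hB₄ : B₄ ≠ ∞)
    (hB₅ : B₅ ≠ ∞) (hB₆ : B₆ ≠ ∞) (hB₇ : B₇ ≠ ∞) (hB₈ : B₈ ≠ ∞)
    (h : A = ENNReal.ofReal c₁ * B₁ + ENNReal.ofReal c₂ * B₂ + ENNReal.ofReal c₃ * B₃ +
      ENNReal.ofReal c₄ * B₄ + ENNReal.ofReal c₅ * B₅ + ENNReal.ofReal c₆ * B₆ + ENNReal.ofReal c₇ * B₇ +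
      ENNReal.ofReal c₈ * B₈) :
    A.toReal = c₁ * B₁.toReal + c₂ * B₂.toReal + c₃ * B₃.toReal + c₄ * B₄.toReal + c₅ * B₅.toReal +
      c₆ * B₆.toReal + c₇ * B₇.toReal + c₈ * B₈.toReal := by
  have h6 : ENNReal.ofReal c₁ * B₁ + ENNReal.ofReal c₂ * B₂ + ENNReal.ofReal c₃ * B₃ +
      ENNReal.ofReal c₄ * B₄ + ENNReal.ofReal c₅ * B₅ + ENNReal.ofReal c₆ * B₆ ≠ ∞ :=
    ENNReal.add_ne_top.2 ⟨ENNReal.add_ne_top.2 ⟨ENNReal.add_ne_top.2 ⟨ENNReal.add_ne_top.2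
      ⟨ENNReal.add_ne_top.2 ⟨s4ob_fin_mul hB₁, s4ob_fin_mul hB₂⟩, s4ob_fin_mul hB₃⟩, s4ob_fin_mul hB₄⟩,
      s4ob_fin_mul hB₅⟩, s4ob_fin_mul hB₆⟩
  have h7 : ENNReal.ofReal c₁ * B₁ + ENNReal.ofReal c₂ * B₂ + ENNReal.ofReal c₃ * B₃ +
      ENNReal.ofReal c₄ * B₄ + ENNReal.ofReal c₅ * B₅ + ENNReal.ofReal c₆ * B₆ + ENNReal.ofReal c₇ * B₇ ≠ ∞ :=
    ENNReal.add_ne_top.2 ⟨h6, s4ob_fin_mul hB₇⟩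
  rw [h, ENNReal.toReal_add h7 (s4ob_fin_mul hB₈), ENNReal.toReal_add h6 (s4ob_fin_mul hB₇),
    strip4_toReal6 h₁ h₂ h₃ h₄ h₅ h₆ hB₁ hB₂ hB₃ hB₄ hB₅ hB₆ rfl, s4ob_tr h₇, s4ob_tr h₈]

end ToReal

/-! ## The odd sector as real sequences -/

open Classical in
/-- **The signed odd sector of the width-4 transfer as real sequences.** For `x ≥ 0` and a start-row
pair `(r₁, r₂)` with `r₂ = 3 - r₁`, there are real sequences `a b p q r t : ℕ → ℝ` obeying the signed odd
recursion of `stub_strip4_oddBoxStep`, with the dictionary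
`a n = Z((0,r₁),(n,0)) - Z((0,r₂),(n,0))`, `b n = Z((0,r₁),(n,1)) - Z((0,r₂),(n,1))` (real parts) and the
single-column initial values `a 0 = x^{r₁} - x^{r₂}`-type of `stub_strip4_base`:
for `(r₁,r₂) = (0,3)`: `(1-x³, x-x², x², x, x², x)`; for `(1,2)`: `(x-x², 1-x, x, x², 0, 0)`. [folklore] -/
theorem strip4_oddSector_exists {x : ℝ} (hx0 : 0 ≤ x) (r₁ r₂ : ℤ) (hr : (r₁ = 0 ∧ r₂ = 3) ∨ (r₁ = 1 ∧ r₂ = 2)) :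
    ∃ a b p q r t : ℕ → ℝ,
      ((r₁ = 0 → a 0 = 1 - x ^ 3 ∧ b 0 = x - x ^ 2 ∧ p 0 = x ^ 2 ∧ q 0 = x ∧ r 0 = x ^ 2 ∧ t 0 = x) ∧
       (r₁ = 1 → a 0 = x - x ^ 2 ∧ b 0 = 1 - x ∧ p 0 = x ∧ q 0 = x ^ 2 ∧ r 0 = 0 ∧ t 0 = 0)) ∧
      (∀ L, a (L + 1) = (x - x ^ 4) * a L + (x ^ 2 - x ^ 3) * b L - x ^ 4 * p L - x ^ 5 * q L - x ^ 4 * r L - x ^ 5 * t L ∧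
        b (L + 1) = (x ^ 2 - x ^ 3) * a L + (x - x ^ 2) * b L - x ^ 5 * r L - x ^ 4 * t L ∧
        p (L + 1) = x ^ 3 * a L + x ^ 2 * b L + x ^ 3 * p L + x ^ 4 * q L ∧
        q (L + 1) = x ^ 2 * a L + x ^ 3 * b L + x ^ 4 * p L + x ^ 3 * q L + x ^ 4 * r L ∧
        r (L + 1) = x ^ 3 * a L + x ^ 4 * q L + x ^ 3 * r L + x ^ 4 * t L ∧
        t (L + 1) = x ^ 2 * a L + x ^ 4 * r L + x ^ 3 * t L) ∧
      (∀ n : ℕ, a n = (pathKernel (discreteDomainGraph (rectDomain n 3) 1) x (st 0 r₁) (st n 0)).toReal -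
          (pathKernel (discreteDomainGraph (rectDomain n 3) 1) x (st 0 r₂) (st n 0)).toReal ∧
        b n = (pathKernel (discreteDomainGraph (rectDomain n 3) 1) x (st 0 r₁) (st n 1)).toReal -
          (pathKernel (discreteDomainGraph (rectDomain n 3) 1) x (st 0 r₂) (st n 1)).toReal) := by
  -- the oriented real kernels for a start row `ρ`
  set K : ℤ → ℤ → ℕ → ℝ := fun ρ s n =>
    (pathKernel (discreteDomainGraph (rectDomain n 3) 1) x (st 0 ρ) (st n s)).toReal with hK
  set PP : ℤ → ℤ → ℤ → ℤ → ℕ → ℝ := fun ρ s u v n =>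
    (∑' (γ : (discreteDomainGraph (rectDomain n 3) 1).Path (st 0 ρ) (st n s))
        (γ' : (discreteDomainGraph (rectDomain n 3) 1).Path (st n u) (st n v)),
      (if List.Disjoint γ.1.support γ'.1.support then
        ENNReal.ofReal (x ^ γ.1.length) * ENNReal.ofReal (x ^ γ'.1.length) else 0)).toReal with hPP
  have hid : ((0:ℤ) = 0 ∧ (1:ℤ) = 1 ∧ (2:ℤ) = 2 ∧ (3:ℤ) = 3) ∨ ((0:ℤ) = 3 ∧ (1:ℤ) = 2 ∧ (2:ℤ) = 1 ∧ (3:ℤ) = 0) :=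
    Or.inl ⟨rfl, rfl, rfl, rfl⟩
  have x2 : 0 ≤ x ^ 2 := pow_nonneg hx0 2
  have x3 : 0 ≤ x ^ 3 := pow_nonneg hx0 3
  have x4 : 0 ≤ x ^ 4 := pow_nonneg hx0 4
  have x5 : 0 ≤ x ^ 5 := pow_nonneg hx0 5
  -- the six real recursions (identity row labelling) for every start row `ρ ∈ [0,3]`
  have RC : ∀ ρ : ℤ, 0 ≤ ρ ∧ ρ ≤ 3 → ∀ n : ℕ,
      K ρ 0 (n + 1) = x * K ρ 0 n + x ^ 2 * K ρ 1 n + x ^ 3 * K ρ 2 n + x ^ 4 * K ρ 3 n +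
        x ^ 4 * PP ρ 2 0 1 n + x ^ 5 * PP ρ 3 0 1 n + x ^ 4 * PP ρ 3 0 2 n + x ^ 5 * PP ρ 3 1 2 n := by
    intro ρ hρ n
    have h := stub_strip4_recCorner n hx0 ρ hρ 0 1 2 3 hid
      (stub_strip4_interlaced n ρ hρ 0 1 2 (by norm_num) (by norm_num) (by norm_num) (by norm_num))
      (stub_strip4_interlaced n ρ hρ 0 1 3 (by norm_num) (by norm_num) (by norm_num) (by norm_num))
      (stub_strip4_interlaced n ρ hρ 0 2 3 (by norm_num) (by norm_num) (by norm_num) (by norm_num))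
      (stub_strip4_interlaced n ρ hρ 1 2 3 (by norm_num) (by norm_num) (by norm_num) (by norm_num))
    simp only [hK, hPP]
    exact strip4_toReal8 hx0 x2 x3 x4 x4 x5 x4 x5 (strip4_ne_top _ _ _ _) (strip4_ne_top _ _ _ _)
      (strip4_ne_top _ _ _ _) (strip4_ne_top _ _ _ _) (strip4_pair_ne_top _ _ _ _ _ _)
      (strip4_pair_ne_top _ _ _ _ _ _) (strip4_pair_ne_top _ _ _ _ _ _) (strip4_pair_ne_top _ _ _ _ _ _) h
  have RN : ∀ ρ : ℤ, 0 ≤ ρ ∧ ρ ≤ 3 → ∀ n : ℕ,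
      K ρ 1 (n + 1) = x ^ 2 * K ρ 0 n + x * K ρ 1 n + x ^ 2 * K ρ 2 n + x ^ 3 * K ρ 3 n +
        x ^ 5 * PP ρ 3 0 2 n + x ^ 4 * PP ρ 3 1 2 n := by
    intro ρ hρ n
    have h := stub_strip4_recNear n hx0 ρ hρ 0 1 2 3 hid
      (stub_strip4_interlaced n ρ hρ 0 2 3 (by norm_num) (by norm_num) (by norm_num) (by norm_num))
      (stub_strip4_interlaced n ρ hρ 1 2 3 (by norm_num) (by norm_num) (by norm_num) (by norm_num))
    simp only [hK, hPP]
    exact strip4_toReal6 x2 hx0 x2 x3 x5 x4 (strip4_ne_top _ _ _ _) (strip4_ne_top _ _ _ _)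
      (strip4_ne_top _ _ _ _) (strip4_ne_top _ _ _ _) (strip4_pair_ne_top _ _ _ _ _ _)
      (strip4_pair_ne_top _ _ _ _ _ _) h
  have RP1 : ∀ ρ : ℤ, 0 ≤ ρ ∧ ρ ≤ 3 → ∀ n : ℕ,
      PP ρ 2 0 1 (n + 1) = x ^ 2 * K ρ 2 n + x ^ 3 * K ρ 3 n + x ^ 3 * PP ρ 2 0 1 n +
        x ^ 4 * PP ρ 3 0 1 n := by
    intro ρ hρ n
    have h := stub_strip4_recPair201 n hx0 ρ hρ 0 1 2 3 hid
    simp only [hK, hPP]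
    exact strip4_toReal4 x2 x3 x3 x4 (strip4_ne_top _ _ _ _) (strip4_ne_top _ _ _ _)
      (strip4_pair_ne_top _ _ _ _ _ _) (strip4_pair_ne_top _ _ _ _ _ _) h
  have RP2 : ∀ ρ : ℤ, 0 ≤ ρ ∧ ρ ≤ 3 → ∀ n : ℕ,
      PP ρ 3 0 1 (n + 1) = x ^ 3 * K ρ 2 n + x ^ 2 * K ρ 3 n + x ^ 4 * PP ρ 2 0 1 n +
        x ^ 3 * PP ρ 3 0 1 n + x ^ 4 * PP ρ 3 0 2 n := by
    intro ρ hρ n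
    have h := stub_strip4_recPair301 n hx0 ρ hρ 0 1 2 3 hid
    simp only [hK, hPP]
    exact strip4_toReal5 x3 x2 x4 x3 x4 (strip4_ne_top _ _ _ _) (strip4_ne_top _ _ _ _)
      (strip4_pair_ne_top _ _ _ _ _ _) (strip4_pair_ne_top _ _ _ _ _ _) (strip4_pair_ne_top _ _ _ _ _ _) h
  have RP3 : ∀ ρ : ℤ, 0 ≤ ρ ∧ ρ ≤ 3 → ∀ n : ℕ,
      PP ρ 3 0 2 (n + 1) = x ^ 3 * K ρ 3 n + x ^ 4 * PP ρ 3 0 1 n + x ^ 3 * PP ρ 3 0 2 n +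
        x ^ 4 * PP ρ 3 1 2 n := by
    intro ρ hρ n
    have h := stub_strip4_recPair302 n hx0 ρ hρ 0 1 2 3 hid
    simp only [hK, hPP]
    exact strip4_toReal4 x3 x4 x3 x4 (strip4_ne_top _ _ _ _) (strip4_pair_ne_top _ _ _ _ _ _)
      (strip4_pair_ne_top _ _ _ _ _ _) (strip4_pair_ne_top _ _ _ _ _ _) h
  have RP4 : ∀ ρ : ℤ, 0 ≤ ρ ∧ ρ ≤ 3 → ∀ n : ℕ,
      PP ρ 3 1 2 (n + 1) = x ^ 2 * K ρ 3 n + x ^ 4 * PP ρ 3 0 2 n + x ^ 3 * PP ρ 3 1 2 n := by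
    intro ρ hρ n
    have h := stub_strip4_recPair312 n hx0 ρ hρ 0 1 2 3 hid
    simp only [hK, hPP]
    exact strip4_toReal3 x2 x4 x3 (strip4_ne_top _ _ _ _) (strip4_pair_ne_top _ _ _ _ _ _)
      (strip4_pair_ne_top _ _ _ _ _ _) h
  -- the reflection `j ↦ 3 - j` of the point kernels
  have KR : ∀ (ρ s : ℤ) (n : ℕ), K ρ s n = K (3 - ρ) (3 - s) n := by
    intro ρ s n
    simp only [hK]
    rw [(stub_rect_reflect n 3 x 0 ρ n s).2]
    norm_num
  -- the single-column initial values
  have BK : ∀ ρ : ℤ, 0 ≤ ρ ∧ ρ ≤ 3 → ∀ s : ℤ, 0 ≤ s ∧ s ≤ 3 → ∀ k : ℕ, (ρ - s).natAbs = k →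
      K ρ s 0 = x ^ k := by
    intro ρ hρ s hs k hk
    have h := congrArg ENNReal.toReal ((stub_strip4_base hx0 ρ hρ).1 s hs)
    rw [hk, ENNReal.toReal_ofReal (pow_nonneg hx0 _)] at h
    exact h
  have BP : ∀ ρ : ℤ, 0 ≤ ρ ∧ ρ ≤ 3 → ∀ s u v : ℤ, 0 ≤ u → u < v → v ≤ 3 → 0 ≤ s → s ≤ 3 →
      (s < u ∨ v < s) → ∀ k : ℕ, (ρ - s).natAbs + (v - u).natAbs = k →
      PP ρ s u v 0 = if (ρ < u ∧ s < u) ∨ (v < ρ ∧ v < s) then x ^ k else 0 := by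
    intro ρ hρ s u v hu huv hv hs0 hs3 hout k hk
    have h := congrArg ENNReal.toReal ((stub_strip4_base hx0 ρ hρ).2 s u v hu huv hv hs0 hs3 hout)
    rw [hk] at h
    refine h.trans ?_
    split_ifs
    · exact ENNReal.toReal_ofReal (pow_nonneg hx0 _)
    · exact ENNReal.toReal_zero
  -- the start rows
  have hr2 : r₂ = 3 - r₁ := by rcases hr with ⟨rfl, rfl⟩ | ⟨rfl, rfl⟩ <;> norm_num
  have hρ1 : 0 ≤ r₁ ∧ r₁ ≤ 3 := by rcases hr with ⟨rfl, -⟩ | ⟨rfl, -⟩ <;> norm_num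
  have hρ2 : 0 ≤ r₂ ∧ r₂ ≤ 3 := by rcases hr with ⟨-, rfl⟩ | ⟨-, rfl⟩ <;> norm_num
  have F1 : ∀ n, K r₁ 2 n = K r₂ 1 n := fun n => by rw [KR r₁ 2 n, hr2]; norm_num
  have F2 : ∀ n, K r₂ 2 n = K r₁ 1 n := fun n => by rw [KR r₂ 2 n, hr2]; norm_num
  have F3 : ∀ n, K r₁ 3 n = K r₂ 0 n := fun n => by rw [KR r₁ 3 n, hr2]; norm_num
  have F4 : ∀ n, K r₂ 3 n = K r₁ 0 n := fun n => by rw [KR r₂ 3 n, hr2]; norm_num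
  clear_value K PP
  refine ⟨fun n => K r₁ 0 n - K r₂ 0 n, fun n => K r₁ 1 n - K r₂ 1 n,
    fun n => -(PP r₁ 2 0 1 n - PP r₂ 2 0 1 n), fun n => -(PP r₁ 3 0 1 n - PP r₂ 3 0 1 n),
    fun n => -(PP r₁ 3 0 2 n - PP r₂ 3 0 2 n), fun n => PP r₂ 3 1 2 n - PP r₁ 3 1 2 n,
    ⟨?_, ?_⟩, fun L => ?_, fun n => ⟨by simp only [hK], by simp only [hK]⟩⟩
  · -- initial values for `(r₁, r₂) = (0, 3)`
    rintro rfl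
    obtain rfl : r₂ = 3 := by rw [hr2]; norm_num
    have h0 : (0:ℤ) ≤ 0 ∧ (0:ℤ) ≤ 3 := by norm_num
    have h1 : (0:ℤ) ≤ 1 ∧ (1:ℤ) ≤ 3 := by norm_num
    have h3 : (0:ℤ) ≤ 3 ∧ (3:ℤ) ≤ 3 := by norm_num
    refine ⟨?_, ?_, ?_, ?_, ?_, ?_⟩
    · show K 0 0 0 - K 3 0 0 = _
      rw [BK 0 h0 0 h0 0 (by decide), BK 3 h3 0 h0 3 (by decide)]; ring
    · show K 0 1 0 - K 3 1 0 = _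
      rw [BK 0 h0 1 h1 1 (by decide), BK 3 h3 1 h1 2 (by decide)]; ring
    · show -(PP 0 2 0 1 0 - PP 3 2 0 1 0) = _
      rw [BP 0 h0 2 0 1 le_rfl (by norm_num) (by norm_num) (by norm_num) (by norm_num) (Or.inr (by norm_num))
          3 (by decide),
        BP 3 h3 2 0 1 le_rfl (by norm_num) (by norm_num) (by norm_num) (by norm_num) (Or.inr (by norm_num))
          2 (by decide), if_neg (by norm_num), if_pos (by norm_num)]
      ring
    · show -(PP 0 3 0 1 0 - PP 3 3 0 1 0) = _
      rw [BP 0 h0 3 0 1 le_rfl (by norm_num) (by norm_num) (by norm_num) le_rfl (Or.inr (by norm_num))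
          4 (by decide),
        BP 3 h3 3 0 1 le_rfl (by norm_num) (by norm_num) (by norm_num) le_rfl (Or.inr (by norm_num))
          1 (by decide), if_neg (by norm_num), if_pos (by norm_num)]
      ring
    · show -(PP 0 3 0 2 0 - PP 3 3 0 2 0) = _
      rw [BP 0 h0 3 0 2 le_rfl (by norm_num) (by norm_num) (by norm_num) le_rfl (Or.inr (by norm_num))
          5 (by decide),
        BP 3 h3 3 0 2 le_rfl (by norm_num) (by norm_num) (by norm_num) le_rfl (Or.inr (by norm_num))
          2 (by decide), if_neg (by norm_num), if_pos (by norm_num)]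
      ring
    · show PP 3 3 1 2 0 - PP 0 3 1 2 0 = _
      rw [BP 3 h3 3 1 2 (by norm_num) (by norm_num) (by norm_num) (by norm_num) le_rfl (Or.inr (by norm_num))
          1 (by decide),
        BP 0 h0 3 1 2 (by norm_num) (by norm_num) (by norm_num) (by norm_num) le_rfl (Or.inr (by norm_num))
          4 (by decide), if_pos (by norm_num), if_neg (by norm_num)]
      ring
  · -- initial values for `(r₁, r₂) = (1, 2)`
    rintro rfl
    obtain rfl : r₂ = 2 := by rw [hr2]; norm_num
    have h0 : (0:ℤ) ≤ 0 ∧ (0:ℤ) ≤ 3 := by norm_num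
    have h1 : (0:ℤ) ≤ 1 ∧ (1:ℤ) ≤ 3 := by norm_num
    have h2 : (0:ℤ) ≤ 2 ∧ (2:ℤ) ≤ 3 := by norm_num
    refine ⟨?_, ?_, ?_, ?_, ?_, ?_⟩
    · show K 1 0 0 - K 2 0 0 = _
      rw [BK 1 h1 0 h0 1 (by decide), BK 2 h2 0 h0 2 (by decide)]; ring
    · show K 1 1 0 - K 2 1 0 = _
      rw [BK 1 h1 1 h1 0 (by decide), BK 2 h2 1 h1 1 (by decide)]; ring
    · show -(PP 1 2 0 1 0 - PP 2 2 0 1 0) = _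
      rw [BP 1 h1 2 0 1 le_rfl (by norm_num) (by norm_num) (by norm_num) (by norm_num) (Or.inr (by norm_num))
          2 (by decide),
        BP 2 h2 2 0 1 le_rfl (by norm_num) (by norm_num) (by norm_num) (by norm_num) (Or.inr (by norm_num))
          1 (by decide), if_neg (by norm_num), if_pos (by norm_num)]
      ring
    · show -(PP 1 3 0 1 0 - PP 2 3 0 1 0) = _
      rw [BP 1 h1 3 0 1 le_rfl (by norm_num) (by norm_num) (by norm_num) le_rfl (Or.inr (by norm_num))
          3 (by decide),
        BP 2 h2 3 0 1 le_rfl (by norm_num) (by norm_num) (by norm_num) le_rfl (Or.inr (by norm_num))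
          2 (by decide), if_neg (by norm_num), if_pos (by norm_num)]
      ring
    · show -(PP 1 3 0 2 0 - PP 2 3 0 2 0) = _
      rw [BP 1 h1 3 0 2 le_rfl (by norm_num) (by norm_num) (by norm_num) le_rfl (Or.inr (by norm_num))
          4 (by decide),
        BP 2 h2 3 0 2 le_rfl (by norm_num) (by norm_num) (by norm_num) le_rfl (Or.inr (by norm_num))
          3 (by decide), if_neg (by norm_num), if_neg (by norm_num)]
      ring
    · show PP 2 3 1 2 0 - PP 1 3 1 2 0 = _
      rw [BP 2 h2 3 1 2 (by norm_num) (by norm_num) (by norm_num) (by norm_num) le_rfl (Or.inr (by norm_num))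
          2 (by decide),
        BP 1 h1 3 1 2 (by norm_num) (by norm_num) (by norm_num) (by norm_num) le_rfl (Or.inr (by norm_num))
          3 (by decide), if_neg (by norm_num), if_neg (by norm_num)]
      ring
  · -- the signed odd recursion
    have C1 := RC r₁ hρ1 L
    have C2 := RC r₂ hρ2 L
    have N1 := RN r₁ hρ1 L
    have N2 := RN r₂ hρ2 L
    have P1 := RP1 r₁ hρ1 L
    have P2 := RP1 r₂ hρ2 L
    have Q1 := RP2 r₁ hρ1 L
    have Q2 := RP2 r₂ hρ2 L
    have S1 := RP3 r₁ hρ1 L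
    have S2 := RP3 r₂ hρ2 L
    have T1 := RP4 r₁ hρ1 L
    have T2 := RP4 r₂ hρ2 L
    have f1 := F1 L
    have f2 := F2 L
    have f3 := F3 L
    have f4 := F4 L
    refine ⟨?_, ?_, ?_, ?_, ?_, ?_⟩
    · simp only [C1, C2, f1, f2, f3, f4]; ring
    · simp only [N1, N2, f1, f2, f3, f4]; ring
    · simp only [P1, P2, f1, f2, f3, f4]; ring
    · simp only [Q1, Q2, f1, f2, f3, f4]; ring
    · simp only [S1, S2, f3, f4]; ring
    · simp only [T1, T2, f3, f4]; ring

end Summit.CriticalPhenomena.SAWScalingLimit.Theorems.BoundaryTP2
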